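import Summits.BirchSwinnertonDyer.Rank1Residual.Additive.GreenbergKummerTwistDescentGeom
import Summits.BirchSwinnertonDyer.Rank1Residual.Additive.GordRamifiedOrdinaryLine
import HarnessLib

/-!
# 'Kummer ⊆ Greenberg' for the TWISTED datum of `E = C • V^{(c)}` at every level where the twist
# transport is equivariant, and 'Greenberg = strict' at `ker κ` — row T-RD-Δ-K file F7a (the
# level-`H` half of the (G-ord) '≥' COMPANION; cell `b2b-bsdres`, team n1011; lead R5-47 (a);
# cc-typer-2's bridge lemma (B1), level part; seat n1011-p05 gen 4)

HONEST FRAMING (cell `b2b-bsdres`, run/shared/lean/b2b/bsd-rank1-residual/, verbatim in every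
file): the goal of the cell is to DELETE the COMBINATION-SHAPED residual classes of the
Birch–Swinnerton-Dyer formula for ALL analytic-rank `≤ 1` elliptic curves over `ℚ` — "full BSD
formula for every rank `≤ 1` curve in class `C`" assembled STRICTLY from published theorems — so
that the rank-`≤ 1` remainder becomes exactly the CONSTRUCTION-SHAPED classes, which are TYPED
(missing-input `Prop`s), NOT attempted. This is not "finishing BSD". Team n1011 (X4 ∧ `p = 3`,
§I N10/N11; ROUTE-2 of planner r2, §II.15.3 ARM δ): research route; TOOL theorems of Galois
cohomology, ALL UNCONDITIONAL (no named fact enters this file); no definition, no named fact by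
this seat; nothing booked; no label changes.

## What

Objects as in F5 `GreenbergKummerTwistDescent` / F6 `GreenbergKummerTwistDescentGeom`: `V/ℚ`
globally minimal with good reduction at `p ∈ v` (`p ∤ Δ_V`), Greenberg's datum
`N_V = reductionDatum V p` (`C_p = ker(V[p^∞] → Ṽ[p^∞])`, X2 lineage), a `ℤ_p`-extension `κ`
(`ker κ = Gal(ℚ̄/ℚ_∞)` when cyclotomic), `K = ℚ(θ)`, `θ² = c`, `U = galRange K`, a transport
`t : V[p^∞] ≃+ W[p^∞]` with a sign rule, and the transported datum `N_W = twistMap N_V t` (p10).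

* §1 `localKerOver_le_greenbergKer_twistMap` — at ANY level `H` on which `t` is equivariant and the
  Kummer square holds: `W.localKerOver p H ℚ_v ≤ N_W.greenbergKer H`. Proof: pull a Kummer class
  of `W` back along `h1Equiv t` (Kummer square `hKum`), apply X2's THEOREM
  `GreenbergVatsalSelmerLink.localKerOver_le_greenbergKer` to `N_V` — its Kummer compatibility is
  `reductionDatum_kummer` (inertia acts trivially on `Ṽ`, so `σP − P ∈ C_p`) — and push forward by
  F4 `mem_greenbergKer_iff_h1Equiv_mem_twistMap`. No fact, no ordinarity, no hypothesis on `W`.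
* §1b `greenbergKer_twistMap_kerSubgroup_eq_strictKer` — at `ker κ` (`κ` cyclotomic, `p ≠ 2`),
  Greenberg's inertia condition = the strict condition for `N_W`, because an element of
  `I_v ∩ ker κ` at which `t` is anti-equivariant acts as `−1` on `N_W.Gr ≅ Ṽ[p^∞] ⊗ χ_c` (the step
  buried in F5's end theorem, exposed by name).
* §2 the geometric transport `t = twistPrimaryEquiv⁻¹ ≫ primaryIso` (additive-p1; F6 §1–§2
  discharge equivariance on `galRange K` and the Kummer square):
  `localKerOver_le_greenbergKer_twistMap_geomTransport_of_le / _inf` (levels `H ≤ galRange K`,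
  `ker κ ⊓ galRange K`), and `isRamifiedOrdinaryLine_twistMap_geomTransport` — the twisted datum IS
  a ramified ordinary line of `W` (p10 `isRamifiedOrdinaryLine_twistMap`; needs `p ∤ a_p(V)`,
  `ord_v c = 1`).

X2's lemma is NEVER applied to the twisted datum at level `ker κ` itself: there its hypothesis
`hN` FAILS (for `σ ∈ I_v` with `σ√c = −√c` — F6's witness, `ord_v c = 1` — and `P = t(m₀) ∈ W[p^∞]`
with `m₀ ∉ C_p`: `σP − P = −t(σm₀ + m₀) ≡ −2P (mod t(C_p))`, which is not in `t(C_p)` as `p` is odd;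
cc-typer-2 INBOX 2026-08-21T11:51Z (a), p07 `skel/T-RD-M.md` §4). The passage from
`ker κ ⊓ galRange K` to `ker κ` is p07's prime-to-`p` ASCENT (`GaloisImage.GreenbergKerCoprimeAscent`,
index `[Γ_ℚ : galRange K] = 2` prime to the odd `p`) — file F7 `KummerLeGreenbergTwistAscent`.

References: [GreenbergLNM1716] §2 pp. 69–75 (`Sel_E ⊆ S_A` at `v ∣ p`, Props. 2.2/2.4);
[GreenbergVatsal2000] §2 p. 26; [SilvermanAEC2009] X.5 Cor. 5.4; [EmertonPollackWeston2006] §3.1.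
-/

noncomputable section

open scoped Classical

namespace Summit.BirchSwinnertonDyer.Rank1Residual.Additive.TameDescent

open NumberField IsDedekindDomain Field Literature.NumberTheory.GaloisRepresentations
  Literature.NumberTheory.EllipticCurves Literature.NumberTheory.EllipticCurves.GreenbergSelmer
  Literature.NumberTheory.EllipticCurves.Greenberg1999
  Literature.NumberTheory.EllipticCurves.EmertonPollackWeston2006 WeierstrassCurve
  Summit.BirchSwinnertonDyer.Rank1Residual.X2.GreenbergVatsalReductionDatum
  Summit.BirchSwinnertonDyer.Rank1Residual.X2.GreenbergVatsalStrictAtPQuotient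
  Summit.BirchSwinnertonDyer.Rank1Residual.X2.GreenbergVatsalSelmerLink
  Summit.BirchSwinnertonDyer.Rank1Residual.GaloisImage
  Summit.BirchSwinnertonDyer.Rank1Residual.GaloisImage.RamifiedOrdinaryLineTwist
  Summit.BirchSwinnertonDyer.Rank1Residual.AdditivePotMult

/-! ## §1 Any level `H` on which the transport is equivariant (generic `t`) -/

section Generic

variable (V : WeierstrassCurve ℚ) [V.IsElliptic] [V.IsGloballyMinimal] (p : ℕ) [Fact p.Prime]
  {v : HeightOneSpectrum (𝓞 ℚ)} {W : WeierstrassCurve ℚ}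
  (t : V.geomPrimaryTorsion p ≃+ W.geomPrimaryTorsion p)
  (tsign : ∀ g : absoluteGaloisGroup ℚ, (∀ m, t (g • m) = g • t m) ∨ (∀ m, t (g • m) = -(g • t m)))

omit [V.IsElliptic] in
/-- **'Kummer ⊆ Greenberg' for the transported datum at a level `H` where `t` is equivariant.**
If the Kummer conditions of `V` and `W` correspond under `h1Equiv t` at level `H` (`hKum`), then
`W.localKerOver p H ℚ_v ≤ (twistMap (reductionDatum V p) t).greenbergKer H` — from X2's
`localKerOver_le_greenbergKer` for Greenberg's datum of the good-reduction curve `V` (Kummer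
compatibility `reductionDatum_kummer`) and the transport of Greenberg's condition along `t`.
UNCONDITIONAL. [cite: GreenbergLNM1716, §2 pp. 69–75] [cite: SilvermanAEC2009, X.5 Cor. 5.4] -/
theorem localKerOver_le_greenbergKer_twistMap (hΔ : ¬ (p : ℤ) ∣ V.minimalDiscriminantInt)
    (hpv : ((p : ℕ) : 𝓞 ℚ) ∈ v.asIdeal) (H : Subgroup (absoluteGaloisGroup ℚ))
    (ht : ∀ (g : H) (m : V.geomPrimaryTorsion p), t (g • m) = g • t m)
    (hKum : ∀ s : V.subgroupH1 p H,
      s ∈ V.localKerOver p H (v.adicCompletion ℚ) ↔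
        h1Equiv (G := H) t ht s ∈ W.localKerOver p H (v.adicCompletion ℚ)) :
    W.localKerOver p H (v.adicCompletion ℚ) ≤
      (twistMap (reductionDatum V p hpv hΔ) t tsign).greenbergKer H := by
  intro s' hs'
  have hV : V.localKerOver p H (v.adicCompletion ℚ) ≤ (reductionDatum V p hpv hΔ).greenbergKer H :=
    localKerOver_le_greenbergKer V p H (reductionDatum V p hpv hΔ) (reductionDatum_kummer V p hpv hΔ)
  have h1 : (h1Equiv (G := H) t ht).symm s' ∈ V.localKerOver p H (v.adicCompletion ℚ) := by
    rw [hKum, AddEquiv.apply_symm_apply]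
    exact hs'
  have h2 := (mem_greenbergKer_iff_h1Equiv_mem_twistMap H (reductionDatum V p hpv hΔ) t tsign ht
    _).1 (hV h1)
  rw [AddEquiv.apply_symm_apply] at h2
  exact h2

end Generic

/-! ## §1b 'Greenberg = strict' at `ker κ` for the transported datum (the step buried in F5's end
theorem, exposed by name) -/

section GrStrict

variable (V : WeierstrassCurve ℚ) [V.IsGloballyMinimal] (p : ℕ) [Fact p.Prime]
  (κ : ZpExtension ℚ p) {v : HeightOneSpectrum (𝓞 ℚ)} {W : WeierstrassCurve ℚ}
  (t : V.geomPrimaryTorsion p ≃+ W.geomPrimaryTorsion p)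
  (tsign : ∀ g : absoluteGaloisGroup ℚ, (∀ m, t (g • m) = g • t m) ∨ (∀ m, t (g • m) = -(g • t m)))
  (K : Type) [Field K] [NumberField K] (h2 : Module.finrank ℚ K = 2) {θ : K} {c : ℚ}
  (hθ : θ ∉ Set.range (algebraMap ℚ K)) (hc : θ ^ 2 = algebraMap ℚ K c)

include h2 hθ hc in
/-- **Greenberg's (inertia) condition = the STRICT condition at `ker κ` for the transported datum**:
an element of `I_v ∩ ker κ` at which `t` is anti-equivariant acts as `−1` on the `p`-primary quotient
`W[p^∞]/t(C_p) ≅ Ṽ[p^∞] ⊗ χ_c` (F4 `exists_inertiaIn_kerSubgroup_map_smul_eq_neg`,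
`smul_eq_neg_twistMap_gr`, X2 `smul_gr_eq_of_mem_inertia`), so it has no non-zero fixed points and
F3 `greenbergKer_eq_strictKer_of_smul_eq_neg` applies. Hypotheses: `p ≠ 2`, `p ∤ Δ_V`, `κ`
cyclotomic, `p ∈ v`, `t` equivariant on `galRange K` and anti-equivariant at some element of
`I_{ℚ_v}`. UNCONDITIONAL. [cite: GreenbergLNM1716, §2 p. 73 and Prop. 2.2]
[cite: GreenbergVatsal2000, §2 p. 26] [cite: SilvermanAEC2009, X.5 Cor. 5.4] -/
theorem greenbergKer_twistMap_kerSubgroup_eq_strictKer (hp2 : p ≠ 2)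
    (hΔ : ¬ (p : ℤ) ∣ V.minimalDiscriminantInt) (hκ : κ.IsCyclotomic)
    (hpv : ((p : ℕ) : 𝓞 ℚ) ∈ v.asIdeal)
    (htU : ∀ g ∈ galRange (K := ℚ) K, ∀ m : V.geomPrimaryTorsion p, t (g • m) = g • t m)
    (hanti : ∃ σ ∈ absInertia (v.adicCompletion ℚ), ∀ m : V.geomPrimaryTorsion p,
      t (absGaloisRestrict ℚ (v.adicCompletion ℚ) σ • m) =
        -(absGaloisRestrict ℚ (v.adicCompletion ℚ) σ • t m)) :
    (twistMap (reductionDatum V p hpv hΔ) t tsign).greenbergKer κ.kerSubgroup =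
      (twistMap (reductionDatum V p hpv hΔ) t tsign).strictKer κ.kerSubgroup := by
  obtain ⟨τ, hτ⟩ := exists_inertiaIn_kerSubgroup_map_smul_eq_neg K h2 hθ hc p t κ hκ hp2 hpv htU hanti
  have hτneg : ∀ d : (twistMap (reductionDatum V p hpv hΔ) t tsign).Gr, τ • d = -d := fun d ↦
    smul_eq_neg_twistMap_gr (reductionDatum V p hpv hΔ) t tsign (τ : decomp (K := ℚ) v) hτ
      (fun d ↦ smul_gr_eq_of_mem_inertia V p hpv hΔ ((mem_inertiaIn_iff κ.kerSubgroup v _).1 τ.2).2 d) d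
  exact greenbergKer_eq_strictKer_of_smul_eq_neg κ.kerSubgroup
    (twistMap (reductionDatum V p hpv hΔ) t tsign) hp2
    (exists_pow_nsmul_eq_zero_twistMap_gr V p t tsign hpv hΔ) τ hτneg

end GrStrict

/-! ## §2 The geometric transport `t = twistPrimaryEquiv⁻¹ ≫ primaryIso` at level
`ker κ ⊓ galRange K` -/

section Geom

variable (V : WeierstrassCurve ℚ) [V.IsGloballyMinimal] (K : Type) [Field K]
  [NumberField K] (h2 : Module.finrank ℚ K = 2) {θ : K} {c : ℚ} (hθ : θ ∉ Set.range (algebraMap ℚ K))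
  (hc : θ ^ 2 = algebraMap ℚ K c) (p : ℕ) [Fact p.Prime] {W : WeierstrassCurve ℚ}
  {C : VariableChange ℚ} (hC : C • V.quadraticTwist c = W)

include h2 in
/-- **'Kummer ⊆ Greenberg' at level `H ≤ galRange K` for `W = C • V^{(c)}` and the geometric
transport**, every transport hypothesis discharged (F6 `geomTransport_smul_of_mem`,
`mem_localKerOver_iff_h1Equiv_geomTransport`): hypotheses ONLY `p ∤ Δ_V`, `p ∈ v`, `[K:ℚ] = 2`,
`C • V^{(c)} = W`. UNCONDITIONAL. [cite: GreenbergLNM1716, §2 pp. 69–75]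
[cite: SilvermanAEC2009, X.5 Cor. 5.4] -/
theorem localKerOver_le_greenbergKer_twistMap_geomTransport_of_le
    (hΔ : ¬ (p : ℤ) ∣ V.minimalDiscriminantInt) {v : HeightOneSpectrum (𝓞 ℚ)}
    (hpv : ((p : ℕ) : 𝓞 ℚ) ∈ v.asIdeal) (H : Subgroup (absoluteGaloisGroup ℚ))
    (hH : H ≤ galRange (K := ℚ) K) :
    W.localKerOver p H (v.adicCompletion ℚ) ≤
      (twistMap (reductionDatum V p hpv hΔ)
        ((twistPrimaryEquiv V K hθ hc p).symm.trans (primaryIso p hC))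
        (geomTransport_sign V K h2 hθ hc p hC)).greenbergKer H :=
  localKerOver_le_greenbergKer_twistMap V p
    ((twistPrimaryEquiv V K hθ hc p).symm.trans (primaryIso p hC)) (geomTransport_sign V K h2 hθ hc p hC)
    hΔ hpv H (fun g m ↦ geomTransport_smul_of_mem V K hθ hc p hC (hH g.2) m)
    (fun s ↦ mem_localKerOver_iff_h1Equiv_geomTransport V K hθ hc p hC H hH _ _ s)

include h2 in
/-- The level `ker κ ⊓ galRange K` (`= Gal(ℚ̄/K·ℚ_∞)`) instance, any `ℤ_p`-extension `κ`.
UNCONDITIONAL. [cite: GreenbergLNM1716, §2 pp. 69–75] -/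
theorem localKerOver_le_greenbergKer_twistMap_geomTransport_inf (κ : ZpExtension ℚ p)
    (hΔ : ¬ (p : ℤ) ∣ V.minimalDiscriminantInt) {v : HeightOneSpectrum (𝓞 ℚ)}
    (hpv : ((p : ℕ) : 𝓞 ℚ) ∈ v.asIdeal) :
    W.localKerOver p (κ.kerSubgroup ⊓ galRange (K := ℚ) K) (v.adicCompletion ℚ) ≤
      (twistMap (reductionDatum V p hpv hΔ)
        ((twistPrimaryEquiv V K hθ hc p).symm.trans (primaryIso p hC))
        (geomTransport_sign V K h2 hθ hc p hC)).greenbergKer (κ.kerSubgroup ⊓ galRange (K := ℚ) K) :=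
  localKerOver_le_greenbergKer_twistMap_geomTransport_of_le V K h2 hθ hc p hC hΔ hpv _ inf_le_right

include h2 hc in
/-- **The twisted datum IS a ramified ordinary line of `W`** (cc-typer-2's `IsRamifiedOrdinaryLine`,
the `L` her `RamifiedLineKummerEqAt` quantifies over): p10's `isRamifiedOrdinaryLine_twistMap` for
Greenberg's datum of the good ORDINARY `V` (`reductionDatum_divisible / _plus_ne_top / _plus_ne_bot /
_htriv`) and F6's ramified inertia witness `exists_mem_absInertia_geomTransport_smul_eq_neg`
(`ord_v c = 1`). UNCONDITIONAL. [cite: EmertonPollackWeston2006, §3.1 (arXiv:math/0404484 p. 17)]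
[cite: GreenbergLNM1716, §2 pp. 62–63 and p. 69] [cite: SilvermanAEC2009, X.5 Cor. 5.4] -/
theorem isRamifiedOrdinaryLine_twistMap_geomTransport [V.IsElliptic] (hp2 : p ≠ 2)
    (hΔ : ¬ (p : ℤ) ∣ V.minimalDiscriminantInt) (hord : ¬ (p : ℤ) ∣ V.frobeniusTrace p)
    {v : HeightOneSpectrum (𝓞 ℚ)} (hpv : ((p : ℕ) : 𝓞 ℚ) ∈ v.asIdeal)
    (hval : v.valuation ℚ c = WithZero.exp (-1 : ℤ)) :
    IsRamifiedOrdinaryLine W p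
      (twistMap (reductionDatum V p hpv hΔ)
        ((twistPrimaryEquiv V K hθ hc p).symm.trans (primaryIso p hC))
        (geomTransport_sign V K h2 hθ hc p hC)) :=
  isRamifiedOrdinaryLine_twistMap hp2 (reductionDatum V p hpv hΔ) _ _
    (reductionDatum_divisible V p hpv hΔ hord) (reductionDatum_plus_ne_top V p hpv hΔ hord)
    (reductionDatum_plus_ne_bot V p hpv hΔ hord) (reductionDatum_htriv V p hpv hΔ)
    (exists_mem_absInertia_geomTransport_smul_eq_neg V K h2 hθ hc p hC hp2 hpv hval)

end Geom

end Summit.BirchSwinnertonDyer.Rank1Residual.Additive.TameDescent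

end
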